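import Literature.NumberTheory.Automorphic.UnitaryFormGroupSemiregularProperDiagonal   -- ★∕filed FILE D1b (this seat): `uniformlyProper_diagonal_of_ne`, `stabilizer_single_le_centralizer_of_diagonal`
import Literature.NumberTheory.Automorphic.ArchDiagonalTorus                            -- ★ `circleDiagonal`, `coe_circleDiagonal`, `circleDiagonal_mem_archLocal_diagonal`
import Literature.NumberTheory.Automorphic.ArchLocalRegularTorusClasses                 -- ★ `re_embedding_ne_zero`
import HarnessLib

/-!
# Harish-Chandra's compactness lemma for the circle torus of `G_w = U(σ_w diag α)(ℂ)` ACROSS NONCOMPACT WALLS — modulo the centraliser of the wall point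
# (Rogawski 1990 §4.12 Lemma 4.12.1, §8.2 pp. 114, 122–123; Harish-Chandra–van Dijk 1970 Part I §3 Lemma 22; Deitmar–Echterhoff 2014 Lemma 9.3.3)

Topic `NumberTheory/Automorphic`; namespace `Literature.NumberTheory.Automorphic.UnitaryGroup`.  THEOREMS ONLY (no `def`, no instance, no notation, no axiom, no named fact, no
`sorry`).  Cell `pub/hodgecm-mathlib`, crux H413 (`stmt-HodgeConjecture-24833`), F0∕P3c line LH3 (closer stub `stub_N9`, organ J), brick **(J-DESC) FILE D1c** (seat F0P3a-p08
(g22)): the place-`w` dress of ★ D1b `uniformlyProper_diagonal_of_ne` in the tokens of the torus files — `G_w = archLocal L N (diagonal α) w`, chart `z ↦ circleDiagonal N z`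
(`z : Fin N → Circle`) — i.e. the COMPLEMENT of ★ `ArchLocalTorusOrbitalCompactWall` (F0P3a-p06 (g10)): that file gives joint properness IN `G_w` on block-separated compact
parameter sets with CONSTANT-SIGN blocks (compact walls) and records «noncompact walls: properness FAILS there»; here, on ANY compact set of parameters on which ONE coordinate
`z_k` stays SIMPLE (`z_k ≠ z_j`, `j ≠ k` — the other coordinates may collide, of either sign: the NONCOMPACT walls of `U(2,1)` with `k` the third line), conjugation is
UNIFORMLY PROPER MODULO any `M ≥ Stab(e_k)`, in particular modulo the centraliser `Z(s)` of every semi-regular wall point `s = diag(ζ, …, z_k, …, ζ)` (`Stab(e_k) ≤ Z(s)`).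
This is the «compact modulo `M`» input of the descent ★ `integral_descConj_eq_integral_descConj_descended` ∕ ★ `exists_descended_forall_orbitalIntegral_eq` (D2∕D3),
uniformly near the wall.
* **`uniformlyProper_circleDiagonal_of_ne`** — (HYP) of ★ `continuousOn_integral_descConj_of_uniformlyProper` for the circle-torus chart on `{z ∣ ∀ j ≠ k, z k ≠ z j}` modulo
  `M ≥ Stab(e_k)`;
* **`exists_isCompact_mul_circleDiagonal_of_ne`** — group-level: ONE compact `C′ ⊆ G_w` with `y ∈ C′·M` whenever `y·diag z·y⁻¹ ∈ C`, `z ∈ K`;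
* `stabilizer_single_le_centralizer_circleDiagonal` — `Stab(e_k) ≤ Z(diag z₀)` when `z₀` is constant off `k`.
HONEST LABEL: HC_CM is proved only modulo the 7 printed citations (2 remaining named inputs: hLiu418 = `stmt-HodgeConjecture-24832`, h413 = `stmt-HodgeConjecture-24833`) until rung 0
closes; count-neutral topology under organ J of `stub_N9`.

## References
* [Rogawski1990] J. D. Rogawski, *Automorphic Representations of Unitary Groups in Three Variables*, Ann. of Math. Stud. 123 (1990), §4.12 Lemma 4.12.1 p. 66, §8.2 p. 114 (the
  compactness lemma and its use), §8.2 pp. 122–123 (`U(2,1)`: the wall `γ₂ → γ₀` with noncompact centraliser `U(1,1) × U(1)`), §4.9 p. 54.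
* [HarishChandra1970] Harish-Chandra (notes by G. van Dijk), *Harmonic Analysis on Reductive p-adic Groups*, LNM 162 (1970), Part I §3 Lemma 22.
* [DeitmarEchterhoff2014] A. Deitmar, S. Echterhoff, *Principles of Harmonic Analysis*, 2nd ed. (2014), Lemma 9.3.3.
* [BrockerTomDieck1985] T. Bröcker, T. tom Dieck, *Representations of Compact Lie Groups* (1985), Ch. IV (3.1) (the diagonal torus).
-/

set_option autoImplicit false

noncomputable section

open Matrix MulAction Topology Set NumberField
open scoped MatrixGroups ComplexConjugate Pointwise

namespace Literature.NumberTheory.Automorphic.UnitaryGroup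

section Place

variable (L : Type) [Field L] (N : ℕ) (α : Fin N → L) (w : {w : InfinitePlace L // w.IsComplex})

/-- The form at `w` is diagonal with the REAL non-zero weights `σ_w(α_i)`: hermitian, with a right inverse, and diagonal at every line. [cite: Rogawski1990, §4.9 p. 54] -/
theorem diagonal_map_embedding_hermitian_and_inv (hα : ∀ i, α i ≠ 0) (hreal : ∀ i, (w.1.embedding (α i)).im = 0) :
    ((Matrix.diagonal α).map w.1.embedding).IsHermitian ∧
      (Matrix.diagonal α).map w.1.embedding * Matrix.diagonal (fun i => (w.1.embedding (α i))⁻¹) = 1 ∧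
      (∀ k j : Fin N, j ≠ k → ((Matrix.diagonal α).map w.1.embedding) k j = 0) ∧
      ∀ k : Fin N, ((Matrix.diagonal α).map w.1.embedding) k k ≠ 0 := by
  have hne : ∀ i, w.1.embedding (α i) ≠ 0 := fun i => (_root_.map_ne_zero _).2 (hα i)
  rw [Matrix.diagonal_map (map_zero _)]
  refine ⟨?_, ?_, fun k j hjk => Matrix.diagonal_apply_ne _ (Ne.symm hjk), fun k => by rw [Matrix.diagonal_apply_eq]; exact hne k⟩
  · -- real diagonal ⇒ hermitian
    rw [Matrix.IsHermitian, Matrix.diagonal_conjTranspose]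
    congr 1
    funext i
    exact Complex.conj_eq_iff_im.2 (hreal i)
  · rw [Matrix.diagonal_mul_diagonal, ← Matrix.diagonal_one]
    congr 1
    funext i
    exact mul_inv_cancel₀ (hne i)

/-- **HARISH-CHANDRA'S COMPACTNESS LEMMA FOR THE CIRCLE TORUS OF `G_w`, ACROSS THE NONCOMPACT WALLS.**  `G_w = U(σ_w diag α)(ℂ)` (`α_i ≠ 0`, `σ_w α_i` real, any signature),
`k : Fin N`, `M ≥ Stab(e_k)` a subgroup of `G_w`.  On every compact set `K` of torus parameters on which the coordinate `z_k` is SIMPLE (`z k ≠ z j` for `j ≠ k`; the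
other coordinates unrestricted) conjugation of `diag z` is UNIFORMLY PROPER MODULO `M`: for each compact `C ⊆ G_w` one compact `𝒦 ⊆ G_w ⧸ M` contains `yM` whenever
`y·diag z·y⁻¹ ∈ C` for some `z ∈ K` — the (HYP) binder of ★ `continuousOn_integral_descConj_of_uniformlyProper`, verbatim.  (★ `uniformlyProper_diagonal_of_ne` at
`J = σ_w diag α`, `d z = (z_i)ᵢ`.)  With `N = 3`, `k` the third line and `K` a compact neighbourhood of a semi-regular point of a noncompact wall `z_i = z_j`, `M = Z(s)`:
the input of the descent near the wall. [cite: Rogawski1990, §4.12 Lemma 4.12.1 p. 66; §8.2 p. 114] [cite: HarishChandra1970, Part I §3 Lemma 22] [cite: DeitmarEchterhoff2014, Lemma 9.3.3] -/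
theorem uniformlyProper_circleDiagonal_of_ne (hα : ∀ i, α i ≠ 0) (hreal : ∀ i, (w.1.embedding (α i)).im = 0) (k : Fin N)
    (M : Subgroup ↥(archLocal L N (Matrix.diagonal α) w)) (hM : stabilizer ↥(archLocal L N (Matrix.diagonal α) w) (Pi.single k (1 : ℂ) : Fin N → ℂ) ≤ M) :
    ∀ K ⊆ {z : Fin N → Circle | ∀ j, j ≠ k → z k ≠ z j}, IsCompact K → ∀ C : Set ↥(archLocal L N (Matrix.diagonal α) w), IsCompact C →
      ∃ 𝒦 : Set (↥(archLocal L N (Matrix.diagonal α) w) ⧸ M), IsCompact 𝒦 ∧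
        ∀ z ∈ K, ∀ y : ↥(archLocal L N (Matrix.diagonal α) w),
          y * ⟨circleDiagonal N z, circleDiagonal_mem_archLocal_diagonal L N α w z⟩ * y⁻¹ ∈ C →
            (QuotientGroup.mk y : ↥(archLocal L N (Matrix.diagonal α) w) ⧸ M) ∈ 𝒦 := by
  obtain ⟨hJ, hJJ', hJk, hkk⟩ := diagonal_map_embedding_hermitian_and_inv L N α w hα hreal
  have hd : ∀ i : Fin N, Continuous fun z : Fin N → Circle => ((z i : Circle) : ℂ) :=
    fun i => continuous_subtype_val.comp (continuous_apply i)
  have hc : ∀ z : Fin N → Circle, (((⟨circleDiagonal N z, circleDiagonal_mem_archLocal_diagonal L N α w z⟩ :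
      ↥(archLocal L N (Matrix.diagonal α) w)) : GL (Fin N) ℂ) : Matrix (Fin N) (Fin N) ℂ) = Matrix.diagonal fun i => ((z i : Circle) : ℂ) :=
    fun z => coe_circleDiagonal N z
  have hne : ∀ z ∈ {z : Fin N → Circle | ∀ j, j ≠ k → z k ≠ z j}, ∀ j, j ≠ k → ((z k : Circle) : ℂ) ≠ ((z j : Circle) : ℂ) :=
    fun z hz j hj h => hz j hj (Circle.ext h)
  exact uniformlyProper_diagonal_of_ne hJ hJJ' k (hJk k) (hkk k) M hM
    (fun z => ⟨circleDiagonal N z, circleDiagonal_mem_archLocal_diagonal L N α w z⟩) (fun z i => ((z i : Circle) : ℂ)) hd hc hne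

/-- **Group-level form**: ONE compact `C′ ⊆ G_w` with `y ∈ C′·M` whenever `y·diag z·y⁻¹ ∈ C` for some `z ∈ K` — the uniform `hCM` binder of ★
`exists_descended_forall_orbitalIntegral_eq` ∕ ★ `integral_descConj_eq_integral_descConj_descended`.
[cite: Rogawski1990, §4.12 Lemma 4.12.1 p. 66; §8.2 p. 114] [cite: HarishChandra1970, Part I §3 Lemma 22] -/
theorem exists_isCompact_mul_circleDiagonal_of_ne (hα : ∀ i, α i ≠ 0) (hreal : ∀ i, (w.1.embedding (α i)).im = 0) (k : Fin N)
    (M : Subgroup ↥(archLocal L N (Matrix.diagonal α) w)) (hM : stabilizer ↥(archLocal L N (Matrix.diagonal α) w) (Pi.single k (1 : ℂ) : Fin N → ℂ) ≤ M)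
    {K : Set (Fin N → Circle)} (hKS : K ⊆ {z : Fin N → Circle | ∀ j, j ≠ k → z k ≠ z j}) (hK : IsCompact K)
    {C : Set ↥(archLocal L N (Matrix.diagonal α) w)} (hC : IsCompact C) :
    ∃ C' : Set ↥(archLocal L N (Matrix.diagonal α) w), IsCompact C' ∧
      ∀ z ∈ K, ∀ y : ↥(archLocal L N (Matrix.diagonal α) w),
        y * ⟨circleDiagonal N z, circleDiagonal_mem_archLocal_diagonal L N α w z⟩ * y⁻¹ ∈ C → y ∈ C' * (M : Set ↥(archLocal L N (Matrix.diagonal α) w)) := by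
  obtain ⟨hJ, hJJ', hJk, hkk⟩ := diagonal_map_embedding_hermitian_and_inv L N α w hα hreal
  have hd : ∀ i : Fin N, Continuous fun z : Fin N → Circle => ((z i : Circle) : ℂ) :=
    fun i => continuous_subtype_val.comp (continuous_apply i)
  have hc : ∀ z : Fin N → Circle, (((⟨circleDiagonal N z, circleDiagonal_mem_archLocal_diagonal L N α w z⟩ :
      ↥(archLocal L N (Matrix.diagonal α) w)) : GL (Fin N) ℂ) : Matrix (Fin N) (Fin N) ℂ) = Matrix.diagonal fun i => ((z i : Circle) : ℂ) :=
    fun z => coe_circleDiagonal N z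
  have hne : ∀ z ∈ {z : Fin N → Circle | ∀ j, j ≠ k → z k ≠ z j}, ∀ j, j ≠ k → ((z k : Circle) : ℂ) ≠ ((z j : Circle) : ℂ) :=
    fun z hz j hj h => hz j hj (Circle.ext h)
  exact exists_isCompact_mul_diagonal_of_ne hJ hJJ' k (hJk k) (hkk k) M hM
    (fun z => ⟨circleDiagonal N z, circleDiagonal_mem_archLocal_diagonal L N α w z⟩) (fun z i => ((z i : Circle) : ℂ)) hd hc hne hKS hK hC

/-- **`Stab(e_k) ≤ Z(diag z₀)` in `G_w` for a torus point constant off the line `k`** (`z₀ j = ζ` for `j ≠ k`): the semi-regular wall points, whose centraliser is the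
descent group `M`. [cite: Rogawski1990, §8.2 pp. 122–123] [cite: HarishChandra1970, Part I §3 Lemma 22] -/
theorem stabilizer_single_le_centralizer_circleDiagonal (hα : ∀ i, α i ≠ 0) (hreal : ∀ i, (w.1.embedding (α i)).im = 0) (k : Fin N)
    {z₀ : Fin N → Circle} {ζ : Circle} (hz₀ : ∀ j, j ≠ k → z₀ j = ζ) :
    stabilizer ↥(archLocal L N (Matrix.diagonal α) w) (Pi.single k (1 : ℂ) : Fin N → ℂ) ≤
      Subgroup.centralizer ({⟨circleDiagonal N z₀, circleDiagonal_mem_archLocal_diagonal L N α w z₀⟩} : Set ↥(archLocal L N (Matrix.diagonal α) w)) := by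
  obtain ⟨-, -, hJk, hkk⟩ := diagonal_map_embedding_hermitian_and_inv L N α w hα hreal
  exact stabilizer_single_le_centralizer_of_diagonal k (hJk k) (hkk k) _ (v := fun i => ((z₀ i : Circle) : ℂ)) (coe_circleDiagonal N z₀)
    (ζ := ((ζ : Circle) : ℂ)) (fun j hj => by rw [hz₀ j hj])

end Place

end Literature.NumberTheory.Automorphic.UnitaryGroup
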